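import Summits.Ventures.CertifiedArithmetic.LowPrec.DoubleRoundingFMALadderFrame

/-!
# Double rounding of the FMA — every binade above `W` decided exactly (THEOREM D-fma-M∞): the
# decision and the universal cap (THEOREM N-fma-M∞)

HONEST FRAMING: certified error envelopes and provably optimal rounding/accumulation schemes for
low-precision formats under stated cost models; every table by two implementations; no hardware
or vendor claims.

THEOREM D-fma-M∞ (`dFma_ladder_iff`).  Grids nested (`embedsTest`), `2 P_φ ≤ P_ψ`,
`bias φ ≤ bias ψ`, `L_ψ ≤ 2 L_φ`, `L_ψ + P_ψ ≤ L_φ`, `m ≥ 1`, `bias φ ≥ 1`, `m_ψ = m + n` on a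
MIDDLE COLUMN `m + 2 ≤ n ≤ 2m`, `k + m + bias φ = n + 1`, and a source maximum
`M_φ = (2^m + J)·2^(k+i+1)` quanta (`J ≤ 2^m`) in ANY binade `i ≥ 0` above
`W = 2^(m+1+k)·quantum φ`: `DFma φ ψ ↔ fmaLadderTest m n i J = false`.  Completeness
(`not_dFma_of_fmaLadderTest`, §1) needs no window hypothesis: the datum of a passing candidate
is three values of `φ` summing to `μ_t ± d·quantum φ²`, `d = d₁·2^(i'-g) ≤ 2^i'`
(`exists_ladder_data`), on which `fl_φ ∘ fl_ψ ≠ fl_φ` (a tie at `g = 0`,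
`roundNE_roundNE_ne_gmid_tie[_below]`; strictly inside the half-spacing at `g ≥ 1`,
`toRat_roundNE_wide_gmid[_below]` then `toRat_roundNE_gmid[_odd]` against
`toRat_roundNE_above/below_gmid`).  Soundness below the window (`i + 2 ≤ m + bias φ`) is the
frame `ladder_slip_sig`; above it THE UNIVERSAL CAP takes over (THEOREM N-fma-M∞,
`fmaLadderTest_cap`, `not_dFma_middle_cap`): on every middle column the candidate
`(i', j, g, d₁, e) = (2m-n, 0, 2m-n, 1, -1)` — `(2^m - 1)·(2^m + 1) = 2^(2m) - 1`, i.e.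
`a = (2^m - 1)`, `b = 2^m + 1`, `c = (2^(m+1) + 2)·2^(k+2m-n)` quanta summing to one `quantum φ²`
above the midpoint `(2^(m+1) + 1)·2^(k+2m-n)·quantum φ` — passes as soon as
`(i, J) ≥ (2m - n, 1)`, and `2m - n ≤ m - 2 < m + bias - 1`, so NO source format whose largest
value reaches `2^(2m-n)·(W + 2h)` satisfies `DFma` through a middle-column register, whatever its
exponent range.  The least passing `(i, J)` per column is tabulated by implementation A
(`code/enum/fma_ladder_law.py` → `DOUBLE-ROUNDING-FMA.md` §15,
`certs/enum/DOUBLE-ROUNDING-FMA-LADDER.json`): `(0, 1)` on every middle column with `m ≤ 20`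
except `(12, 23) ↦ (0, 2)` (THEOREM D-fma-M♯) and `(16, 31) ↦ (1, 1)` — the cap itself, the
kernel instances being `DoubleRoundingFMALadderTable.lean`.  PLACEMENT: innocuous double rounding
[Figueroa1995] §3, [Roux2014] §2; FMA by rounding to odd [BoldoMelquiond2008] Thm 3; the
midpoint property [MartinDorelMelquiondMuller2013] Property 2.1; no record-level decision of the
FMA through a `2P+1 … 3P-1`-digit register over all source ranges was found in the literature
searched (queries in the cell's notes).  No hardware or vendor claims.
-/

namespace Summit.Ventures.CertifiedArithmetic

open Literature.ComputerArithmetic.FloatingPoint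
open Literature.ComputerArithmetic.FloatingPoint.Format
open Literature.ComputerArithmetic.FloatingPoint.MiniFloat

/-! ## §1 Completeness: every passing candidate refutes `DFma` -/

/-- THEOREM D-fma-M∞, the refutation (completeness of the ladder test, NO window hypothesis):
grids nested (`embedsTest`), `L_ψ ≤ 2 L_φ`, `m ≥ 1`, `bias φ ≥ 1`, `m_ψ = m + n`,
`n ≥ m + 2`, `k + m + bias φ = n + 1`, `M_φ = (2^m + J)·2^(k+i+1)` (any `J`), and
`fmaLadderTest m n i J` ⟹ `¬ DFma φ ψ`: the datum sums to `μ_t ± d·quantum φ²`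
(`+` for `t` even), `d ≤ 2^i'` = half the spacing of `ψ` at `μ_t`; `fl_ψ` returns `μ_t` (a tie
at `g = 0`, resolved onto `μ_t` whose `ψ`-significand is even), and `fl_φ μ_t` is the even
neighbour while `fl_φ` of the sum is the other one. [cite: BoldoMelquiond2008, Thm 3] -/
theorem not_dFma_of_fmaLadderTest {φ ψ : Format} (hE : embedsTest φ ψ = true)
    (hq2 : ψ.qexp ≤ 2 * φ.qexp) (h1 : 1 ≤ φ.manBits) (hb : 1 ≤ φ.bias) {n k i J : ℕ}
    (hn : ψ.manBits = φ.manBits + n) (hn2 : φ.manBits + 2 ≤ n)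
    (hk : k + (φ.manBits + φ.bias) = n + 1)
    (hM : φ.maxScaled = (2 ^ φ.manBits + J) * 2 ^ (k + i + 1))
    (hT : fmaLadderTest φ.manBits n i J = true) : ¬ DFma φ ψ := by
  have hE' := hE
  simp only [embedsTest, Bool.and_eq_true, decide_eq_true_eq] at hE'
  obtain ⟨⟨-, hq⟩, hMψ⟩ := hE'
  have hqφ := φ.quantum_pos
  have hqq : 0 < φ.quantum * φ.quantum := mul_pos hqφ hqφ
  -- the grid of `ψ` is fine enough at the midpoints: `m_ψ ≤ m + k + D`
  set d := (φ.qexp - ψ.qexp).toNat with hd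
  have hd0 : ((d : ℕ) : ℤ) = φ.qexp - ψ.qexp := Int.toNat_of_nonneg (by omega)
  have hk' : ψ.manBits ≤ φ.manBits + k + d := by
    have : (φ.manBits : ℤ) + φ.bias - 1 ≤ d := by unfold Format.qexp at hd0 hq2; omega
    omega
  have hquant : φ.quantum = 2 ^ d * ψ.quantum := quantum_eq_two_pow_mul hq
  have hkey : (2 : ℚ) ^ n * φ.quantum = 2 ^ k := by
    rw [show n = k + (φ.manBits + (φ.bias - 1)) by omega, pow_add, mul_assoc,
      two_pow_mul_quantum_eq_one hb, mul_one]
  have hδψ0 : 2 * (φ.quantum * φ.quantum)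
      = 2 ^ (φ.manBits + k + d + 1 - ψ.manBits) * ψ.quantum := by
    have H : (2 : ℚ) ^ n * (2 * (φ.quantum * φ.quantum))
        = 2 ^ n * (2 ^ (φ.manBits + k + d + 1 - ψ.manBits) * ψ.quantum) := by
      calc (2 : ℚ) ^ n * (2 * (φ.quantum * φ.quantum))
          = 2 * (2 ^ n * φ.quantum) * φ.quantum := by ring
        _ = 2 ^ (k + d + 1) * ψ.quantum := by rw [hkey, hquant, pow_add, pow_succ]; ring
        _ = 2 ^ (n + (φ.manBits + k + d + 1 - ψ.manBits)) * ψ.quantum := by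
            rw [show n + (φ.manBits + k + d + 1 - ψ.manBits) = k + d + 1 by omega]
        _ = 2 ^ n * (2 ^ (φ.manBits + k + d + 1 - ψ.manBits) * ψ.quantum) := by
            rw [pow_add]; ring
    exact mul_left_cancel₀ (by positivity) H
  -- `quantum φ² < 2^k·quantum φ` (`quantum φ ≤ 1/2`)
  have hq2k : φ.quantum * φ.quantum < 2 ^ k * φ.quantum := by
    apply mul_lt_mul_of_pos_right _ hqφ
    have hQ1 := two_pow_mul_quantum_eq_one hb
    have hQ2 : (2 : ℚ) ≤ 2 ^ (φ.manBits + (φ.bias - 1)) := by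
      have : (2:ℚ) ^ 1 ≤ 2 ^ (φ.manBits + (φ.bias - 1)) :=
        pow_le_pow_right₀ (by norm_num) (by omega)
      rwa [pow_one] at this
    have hk1 : (1 : ℚ) ≤ 2 ^ k := one_le_pow₀ (by norm_num)
    nlinarith
  -- read the candidate
  obtain ⟨i', j, g, d₁, e, hi', hj, hg, -, he, hc⟩ := exists_of_fmaLadderTest hT
  simp only [fmaLadderCond, Bool.and_eq_true, decide_eq_true_eq] at hc
  obtain ⟨⟨⟨⟨⟨⟨hv, hw1⟩, hw2⟩, hsh⟩, hd1o⟩, hd1g⟩, hsig⟩ := hc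
  obtain ⟨a₁, b₁, -, ha₁, hb₁, hab⟩ := exists_mul_of_twoSigTest hsig
  obtain ⟨σ, hσ⟩ : ∃ σ : ℤ, σ = if j % 2 = 0 then 1 else -1 := ⟨_, rfl⟩
  have hif : (if j % 2 = 0 then (d₁ : ℤ) else -(d₁ : ℤ)) = σ * d₁ := by
    rw [hσ]; split_ifs <;> ring
  rw [hif] at hab
  obtain ⟨a, b, c, habc⟩ :=
    exists_ladder_data hb hn2 hk hM hi' hg hj he hw1 hw2 hsh ha₁ hb₁ hab
  -- the midpoint `t = 2^m + j` of binade `i'`: `t + 1` visible, the grid of `ψ` at `μ_t`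
  have h2e : Even (2 ^ φ.manBits) := Nat.even_pow.mpr ⟨even_two, by omega⟩
  have htlo : 2 ^ φ.manBits ≤ 2 ^ φ.manBits + j := Nat.le_add_right _ _
  have hthi : 2 ^ φ.manBits + j < 2 ^ (φ.manBits + 1) := by rw [pow_succ]; omega
  have hu : (2 ^ φ.manBits + j + 1) * 2 ^ (k + i' + 1) ≤ φ.maxScaled := by
    obtain ⟨r, hr⟩ := Nat.exists_eq_add_of_le hi'
    have e1 : (2 ^ φ.manBits + J) * 2 ^ (i + 1) = (2 ^ φ.manBits + J) * 2 ^ (r + 1) * 2 ^ i' := by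
      rw [hr, mul_assoc, ← pow_add]; congr 2; omega
    rw [e1] at hv
    have h3 : 2 * (2 ^ φ.manBits + j) + 1 < (2 ^ φ.manBits + J) * 2 ^ (r + 1) :=
      Nat.lt_of_mul_lt_mul_right hv
    have e2 : (2 ^ φ.manBits + J) * 2 ^ (r + 1) = (2 ^ φ.manBits + J) * 2 ^ r * 2 := by
      rw [pow_succ, mul_assoc]
    have h4 : 2 ^ φ.manBits + j + 1 ≤ (2 ^ φ.manBits + J) * 2 ^ r := by
      rw [e2] at h3; omega
    rw [hM]
    calc (2 ^ φ.manBits + j + 1) * 2 ^ (k + i' + 1)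
        ≤ (2 ^ φ.manBits + J) * 2 ^ r * 2 ^ (k + i' + 1) := Nat.mul_le_mul_right _ h4
      _ = (2 ^ φ.manBits + J) * 2 ^ (k + i + 1) := by
          rw [hr, mul_assoc, ← pow_add]; congr 2; omega
  have hk'' : ψ.manBits ≤ φ.manBits + (k + i') + d := by omega
  have hP2 : φ.manBits + 2 ≤ ψ.manBits := by omega
  have hδψ : 2 ^ i' * (2 * (φ.quantum * φ.quantum))
      = 2 ^ (φ.manBits + (k + i') + d + 1 - ψ.manBits) * ψ.quantum := by
    rw [hδψ0, ← mul_assoc, ← pow_add]; congr 2; omega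
  have hKq : (2 : ℚ) ^ i' * (φ.quantum * φ.quantum) < 2 ^ (k + i') * φ.quantum := by
    rw [pow_add, mul_comm ((2:ℚ) ^ k), mul_assoc]
    exact mul_lt_mul_of_pos_left hq2k (by positivity)
  intro hD
  have h' := hD a b c
  rw [habc] at h'
  rcases Nat.eq_zero_or_pos g with hg0 | hgpos
  · -- THE TIE (`g = 0`, `d₁ = 1`): the sum is `μ_t ± 2^i'·quantum φ²`
    subst hg0
    have hd11 : d₁ = 1 := by have := hd1g; rw [pow_zero] at this; omega
    subst hd11
    have e0 : (((1 * 2 ^ (i' - 0) : ℕ)) : ℚ) = 2 ^ i' := by push_cast; simp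
    rw [e0] at h'
    by_cases hpar : j % 2 = 0
    · rw [hσ, if_pos hpar] at h'
      have e1 : (((1 : ℤ)) : ℚ) * 2 ^ i' * (φ.quantum * φ.quantum)
          = 2 ^ i' * (φ.quantum * φ.quantum) := by push_cast; ring
      rw [e1] at h'
      have hte : Even (2 ^ φ.manBits + j) := h2e.add (Nat.even_iff.mpr hpar)
      exact roundNE_roundNE_ne_gmid_tie hq hMψ h1 hP2 hte htlo hthi hu hk''
        (by rw [← hδψ]; ring) h'
    · rw [hσ, if_neg hpar] at h'
      have e1 : (((2 * (2 ^ φ.manBits + j) + 1) * 2 ^ (k + i') : ℕ) : ℚ) * φ.quantum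
          + (((-1 : ℤ) : ℚ)) * 2 ^ i' * (φ.quantum * φ.quantum)
          = (((2 * (2 ^ φ.manBits + j) + 1) * 2 ^ (k + i') : ℕ) : ℚ) * φ.quantum
            - 2 ^ i' * (φ.quantum * φ.quantum) := by push_cast; ring
      rw [e1] at h'
      have hto : Odd (2 ^ φ.manBits + j) := h2e.add_odd (Nat.odd_iff.mpr (by omega))
      exact roundNE_roundNE_ne_gmid_tie_below hq hMψ h1 hP2 hto htlo hthi hu hk''
        (by rw [← hδψ]; ring) h'
  · -- STRICTLY INSIDE (`g ≥ 1`): `d = d₁·2^(i'-g) < 2^i'` since `d₁ < 2^g` (`d₁` odd)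
    have hd1lt : d₁ < 2 ^ g := by
      rcases hd1g.lt_or_eq with h0 | h0
      · exact h0
      · exfalso
        have : (2 ^ g) % 2 = 0 := Nat.even_iff.mp (Nat.even_pow.mpr ⟨even_two, by omega⟩)
        omega
    have hdlt : d₁ * 2 ^ (i' - g) < 2 ^ i' := by
      calc d₁ * 2 ^ (i' - g) < 2 ^ g * 2 ^ (i' - g) :=
            Nat.mul_lt_mul_of_pos_right hd1lt (by positivity)
        _ = 2 ^ i' := by rw [← pow_add]; congr 1; omega
    have hd1pos : 0 < d₁ := by
      rcases Nat.eq_zero_or_pos d₁ with h0 | h0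
      · subst h0; simp at hd1o
      · exact h0
    have hδ0 : (0 : ℚ) < ((d₁ * 2 ^ (i' - g) : ℕ) : ℚ) * (φ.quantum * φ.quantum) := by positivity
    have hδ1 : ((d₁ * 2 ^ (i' - g) : ℕ) : ℚ) * (φ.quantum * φ.quantum)
        < 2 ^ i' * (φ.quantum * φ.quantum) := by
      apply mul_lt_mul_of_pos_right _ hqq; exact_mod_cast hdlt
    have hδ2 : 2 * (((d₁ * 2 ^ (i' - g) : ℕ) : ℚ) * (φ.quantum * φ.quantum))
        < 2 ^ (φ.manBits + (k + i') + d + 1 - ψ.manBits) * ψ.quantum := by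
      rw [← hδψ]; linarith
    have hδK : ((d₁ * 2 ^ (i' - g) : ℕ) : ℚ) * (φ.quantum * φ.quantum)
        < 2 ^ (k + i') * φ.quantum := hδ1.trans hKq
    have hP : φ.manBits < ψ.manBits := by omega
    have h2K : 0 < 2 ^ (k + i' + 1) := by positivity
    by_cases hpar : j % 2 = 0
    · rw [hσ, if_pos hpar] at h'
      simp only [Int.cast_one, one_mul] at h'
      have hte : Even (2 ^ φ.manBits + j) := h2e.add (Nat.even_iff.mpr hpar)
      rw [toRat_roundNE_wide_gmid hq hMψ hP htlo hthi hu hk'' hδ0 hδ2,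
        toRat_roundNE_gmid h1 hte htlo hthi hu,
        toRat_roundNE_above_gmid htlo hthi hu hδ0 hδK] at h'
      have h5 : (((2 ^ φ.manBits + j) * 2 ^ (k + i' + 1) : ℕ) : ℚ)
          = (((2 ^ φ.manBits + j + 1) * 2 ^ (k + i' + 1) : ℕ) : ℚ) :=
        mul_right_cancel₀ hqφ.ne' h'
      have h6 : (2 ^ φ.manBits + j) * 2 ^ (k + i' + 1)
          = (2 ^ φ.manBits + j + 1) * 2 ^ (k + i' + 1) := by exact_mod_cast h5
      have := Nat.eq_of_mul_eq_mul_right h2K h6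
      omega
    · rw [hσ, if_neg hpar] at h'
      have e1 : (((2 * (2 ^ φ.manBits + j) + 1) * 2 ^ (k + i') : ℕ) : ℚ) * φ.quantum
          + (((-1 : ℤ) : ℚ)) * ((d₁ * 2 ^ (i' - g) : ℕ) : ℚ) * (φ.quantum * φ.quantum)
          = (((2 * (2 ^ φ.manBits + j) + 1) * 2 ^ (k + i') : ℕ) : ℚ) * φ.quantum
            - ((d₁ * 2 ^ (i' - g) : ℕ) : ℚ) * (φ.quantum * φ.quantum) := by push_cast; ring
      rw [e1] at h'
      have hto : Odd (2 ^ φ.manBits + j) := h2e.add_odd (Nat.odd_iff.mpr (by omega))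
      rw [toRat_roundNE_wide_gmid_below hq hMψ hP htlo hthi hu hk'' hδ0 hδ2,
        toRat_roundNE_gmid_odd h1 hto htlo hthi hu,
        toRat_roundNE_below_gmid htlo hthi hu hδ0 hδK] at h'
      have h5 : (((2 ^ φ.manBits + j + 1) * 2 ^ (k + i' + 1) : ℕ) : ℚ)
          = (((2 ^ φ.manBits + j) * 2 ^ (k + i' + 1) : ℕ) : ℚ) :=
        mul_right_cancel₀ hqφ.ne' h'
      have h6 : (2 ^ φ.manBits + j + 1) * 2 ^ (k + i' + 1)
          = (2 ^ φ.manBits + j) * 2 ^ (k + i' + 1) := by exact_mod_cast h5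
      have := Nat.eq_of_mul_eq_mul_right h2K h6
      omega

/-! ## §2 The decision and the universal cap -/

/-- THEOREM D-fma-M∞, the positive half below the window: under the grid conditions,
`n ≥ m + 2`, `M_φ = (2^m + J)·2^(k+i+1)`, `J ≤ 2^m`, `i + 2 ≤ m + bias φ`, a failing
`fmaLadderTest m n i J` gives `DFma φ ψ` (the frame `ladder_slip_sig` on positive sums, symmetry
and the exact zero / zero-product cases). [this packet] -/
theorem dFma_of_fmaLadderTest_eq_false {φ ψ : Format} (hE : embedsTest φ ψ = true)
    (hm : 2 * φ.manBits + 1 ≤ ψ.manBits) (hbias : φ.bias ≤ ψ.bias) (hq2 : ψ.qexp ≤ 2 * φ.qexp)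
    (hnorm : ψ.qexp + ψ.manBits + 1 ≤ φ.qexp) (h1 : 1 ≤ φ.manBits) (hb : 1 ≤ φ.bias)
    {n k i J : ℕ} (hn : ψ.manBits = φ.manBits + n) (hn2 : φ.manBits + 2 ≤ n)
    (hk : k + (φ.manBits + φ.bias) = n + 1) (hJ : J ≤ 2 ^ φ.manBits)
    (hiA : i + 2 ≤ φ.manBits + φ.bias)
    (hM : φ.maxScaled = (2 ^ φ.manBits + J) * 2 ^ (k + i + 1))
    (hT : fmaLadderTest φ.manBits n i J = false) : DFma φ ψ := by
  have key : ∀ {a b c : MiniFloat φ}, a.scaledMag ≠ 0 → b.scaledMag ≠ 0 →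
      0 < a.toRat * b.toRat + c.toRat →
      (roundNE φ (roundNE ψ (a.toRat * b.toRat + c.toRat)).toRat).toRat
        = (roundNE φ (a.toRat * b.toRat + c.toRat)).toRat := by
    intro a b c ha hb0 hx
    by_contra h
    have hT' := ladder_slip_sig hE hm hbias hq2 hnorm h1 hb hn hn2 hk hJ hiA hM ha hb0 hx h
    rw [hT] at hT'
    exact Bool.false_ne_true hT'
  intro a b c
  by_cases hab : a.scaledMag = 0 ∨ b.scaledMag = 0
  · have h0 : a.toRat * b.toRat = 0 := by
      rcases hab with h0 | h0 <;>
        simp [toRat_eq_toInt_mul a, toRat_eq_toInt_mul b, MiniFloat.toInt, h0]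
    rw [h0, zero_add]
    exact toRat_roundNE_roundNE_of_exists (embeds_of_test hE c)
  simp only [not_or] at hab
  rcases lt_trichotomy (a.toRat * b.toRat + c.toRat) 0 with hneg | h0 | hpos
  · have h := key (a := a.flipSign) (b := b) (c := c.flipSign) hab.1 hab.2
      (by simp only [toRat_flipSign]; linarith)
    simp only [toRat_flipSign] at h
    have e : -a.toRat * b.toRat + -c.toRat = -(a.toRat * b.toRat + c.toRat) := by ring
    rwa [e, toRat_roundNE_neg, toRat_roundNE_neg, toRat_roundNE_neg, neg_inj] at h
  · simp only [h0, toRat_roundNE_zero]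
  · exact key hab.1 hab.2 hpos

/-- THE UNIVERSAL CAP (arithmetic of THEOREM N-fma-M∞): on a column `n ≤ 2m`, `m ≥ 1`
(in particular every middle column `m + 2 ≤ n ≤ 2m`), the candidate
`(i', j, g, d₁, e) = (2m-n, 0, 2m-n, 1, -1)` passes the ladder test for every
`(i, J) ≥ (2m - n, 1)` lexicographically: `2^(2m) - 1 = (2^m - 1)·(2^m + 1)` and
`w = 2^(m+1) + 2` is an even significand-times-two. [this packet] -/
theorem fmaLadderTest_cap {m n i J : ℕ} (h1 : 1 ≤ m) (hn3 : n ≤ 2 * m)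
    (hiJ : 2 * m - n + 1 ≤ i ∨ (2 * m - n = i ∧ 1 ≤ J)) : fmaLadderTest m n i J = true := by
  obtain ⟨G, hG⟩ : ∃ G, G = 2 * m - n := ⟨_, rfl⟩
  have hGi : G ≤ i := by omega
  have hnG : n + G = 2 * m := by omega
  have h2m1 : 1 ≤ 2 ^ m := Nat.one_le_two_pow
  have h2m2 : 2 ≤ 2 ^ m := by
    calc 2 = 2 ^ 1 := (pow_one 2).symm
      _ ≤ 2 ^ m := Nat.pow_le_pow_right (by norm_num) h1
  have hP : 2 ^ (m + 1) = 2 ^ m * 2 := pow_succ 2 m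
  -- the factorization `2^(2m) - 1 = (2^m - 1)·(2^m + 1)`
  have hfac : ((-1 : ℤ) * 2 ^ (n + G) + 1 * ((1 : ℕ) : ℤ)).natAbs
      = (2 ^ m - 1) * (2 ^ m + 1) := by
    have e1 : (-1 : ℤ) * 2 ^ (n + G) + 1 * ((1 : ℕ) : ℤ)
        = -((((2 ^ m - 1) * (2 ^ m + 1) : ℕ)) : ℤ) := by
      rw [hnG, Nat.cast_mul, Nat.cast_sub h2m1]; push_cast; ring
    rw [e1, Int.natAbs_neg, Int.natAbs_natCast]
  have hsig : twoSigTest (m + 1) ((-1 : ℤ) * 2 ^ (n + G) + 1 * ((1 : ℕ) : ℤ)).natAbs = true := by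
    rw [hfac]
    exact twoSigTest_mul_eq_true (by omega) (by rw [hP]; omega) (by rw [hP]; omega)
  -- the range: `(2^(m+1) + 1)·2^G < (2^m + J)·2^(i+1)` and `(2^(m+1) + 2)·2^G ≤ (2^m + J)·2^(i+1)`
  have hR : (2 ^ m * 2 + 2) * 2 ^ G ≤ (2 ^ m + J) * 2 ^ (i + 1) := by
    rcases hiJ with h0 | ⟨h0, hJ1⟩
    · calc (2 ^ m * 2 + 2) * 2 ^ G ≤ (2 ^ m * 4) * 2 ^ G := Nat.mul_le_mul_right _ (by omega)
        _ = 2 ^ m * 2 ^ (G + 2) := by rw [pow_add]; ring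
        _ ≤ (2 ^ m + J) * 2 ^ (i + 1) :=
            Nat.mul_le_mul (Nat.le_add_right _ _) (Nat.pow_le_pow_right (by norm_num) (by omega))
    · have hi : i = G := by omega
      subst hi
      calc (2 ^ m * 2 + 2) * 2 ^ i = (2 ^ m + 1) * 2 ^ (i + 1) := by rw [pow_succ]; ring
        _ ≤ (2 ^ m + J) * 2 ^ (i + 1) := Nat.mul_le_mul_right _ (by omega)
  refine fmaLadderTest_eq_true_of (i' := G) (j := 0) (g := G) (d₁ := 1) (e := -1) hGi
    (by positivity) le_rfl Nat.one_le_two_pow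
    (by rw [abs_neg, abs_one]; exact one_le_pow₀ (by norm_num)) ?_
  have hRz : (((2 : ℤ) ^ m * 2 + 2)) * 2 ^ G ≤ (2 ^ m + J) * 2 ^ (i + 1) := by exact_mod_cast hR
  simp only [fmaLadderCond, Bool.and_eq_true, decide_eq_true_eq, Nat.zero_mod, if_true,
    Nat.cast_zero, add_zero]
  refine ⟨⟨⟨⟨⟨⟨lt_of_lt_of_le (Nat.mul_lt_mul_of_pos_right (by omega) (by positivity)) hR,
    by linarith⟩, ?_⟩, ?_⟩, by decide⟩, Nat.one_le_two_pow⟩, ?_⟩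
  · have e1 : (2 * (2 : ℤ) ^ m + 1 - -1) = 2 ^ m * 2 + 2 := by ring
    rw [e1]; exact hRz
  · have e1 : (2 * (2 : ℤ) ^ m + 1 - -1) = ((2 ^ m + 1) * 2 ^ 1 : ℕ) := by push_cast; ring
    rw [e1]; exact fmaShape_natMul_pow (by omega)
  · have e1 : (-1 : ℤ) * 2 ^ (n + G) + ((1 : ℕ) : ℤ)
        = (-1 : ℤ) * 2 ^ (n + G) + 1 * ((1 : ℕ) : ℤ) := by ring
    rw [e1]; exact hsig

/-- THEOREM D-fma-M∞ — EVERY BINADE ABOVE `W` DECIDED EXACTLY.  Grids nested (`embedsTest`),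
`2 P_φ ≤ P_ψ`, `bias φ ≤ bias ψ`, `L_ψ ≤ 2 L_φ`, `L_ψ + P_ψ ≤ L_φ`, `m ≥ 1`, `bias φ ≥ 1`,
`m_ψ = m + n` on a middle column `m + 2 ≤ n ≤ 2m`, `k + m + bias φ = n + 1`, and a source maximum
`M_φ = (2^m + J)·2^(k+i+1)` quanta, `J ≤ 2^m`, `i ≥ 0` arbitrary:
`DFma φ ψ ↔ fmaLadderTest m n i J = false`.  Below the window (`i + 2 ≤ m + bias`) by the frame;
above it `i ≥ m + bias - 1 ≥ 2m - n + 1` and the universal cap passes the test while completeness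
refutes `DFma`.  The test is monotone in `(i, J)` (`fmaLadderTest_mono`); its least passing
`(i, J)` per column is `DoubleRoundingFMALadderTable.lean`. [this packet] -/
theorem dFma_ladder_iff {φ ψ : Format} (hE : embedsTest φ ψ = true)
    (hm : 2 * φ.manBits + 1 ≤ ψ.manBits) (hbias : φ.bias ≤ ψ.bias) (hq2 : ψ.qexp ≤ 2 * φ.qexp)
    (hnorm : ψ.qexp + ψ.manBits + 1 ≤ φ.qexp) (h1 : 1 ≤ φ.manBits) (hb : 1 ≤ φ.bias)
    {n k i J : ℕ} (hn : ψ.manBits = φ.manBits + n) (hn2 : φ.manBits + 2 ≤ n)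
    (hn3 : n ≤ 2 * φ.manBits) (hk : k + (φ.manBits + φ.bias) = n + 1) (hJ : J ≤ 2 ^ φ.manBits)
    (hM : φ.maxScaled = (2 ^ φ.manBits + J) * 2 ^ (k + i + 1)) :
    DFma φ ψ ↔ fmaLadderTest φ.manBits n i J = false := by
  constructor
  · intro hD
    by_contra hT
    exact not_dFma_of_fmaLadderTest hE hq2 h1 hb hn hn2 hk hM (by simpa using hT) hD
  · intro hT
    rcases Nat.lt_or_ge (i + 1) (φ.manBits + φ.bias) with hiA | hiA
    · exact dFma_of_fmaLadderTest_eq_false hE hm hbias hq2 hnorm h1 hb hn hn2 hk hJ (by omega)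
        hM hT
    · exfalso
      have := fmaLadderTest_cap (i := i) (J := J) h1 hn3 (Or.inl (by omega))
      rw [hT] at this
      exact Bool.false_ne_true this

/-- THEOREM N-fma-M∞ (the universal cap, Format level): grids nested (`embedsTest`),
`L_ψ ≤ 2 L_φ`, `m ≥ 1`, `bias φ ≥ 1`, `m_ψ = m + n` on a middle column `m + 2 ≤ n ≤ 2m`,
`k + m + bias φ = n + 1`: NO source format whose largest value is `(2^m + J)·2^(k+i+1)`
quanta with `(i, J) ≥ (2m - n, 1)` — i.e. at least `2^(2m-n)·(W + 2h)`, `h = 2^k·quantum φ` —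
satisfies `DFma φ ψ`, whatever its exponent range (and whatever `J`): the datum
`(2^m - 1)·(2^m + 1) + (2^(m+1) + 2)·2^(k+2m-n)` quanta slips. [this packet] -/
theorem not_dFma_middle_cap {φ ψ : Format} (hE : embedsTest φ ψ = true)
    (hq2 : ψ.qexp ≤ 2 * φ.qexp) (h1 : 1 ≤ φ.manBits) (hb : 1 ≤ φ.bias) {n k i J : ℕ}
    (hn : ψ.manBits = φ.manBits + n) (hn2 : φ.manBits + 2 ≤ n) (hn3 : n ≤ 2 * φ.manBits)
    (hk : k + (φ.manBits + φ.bias) = n + 1)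
    (hM : φ.maxScaled = (2 ^ φ.manBits + J) * 2 ^ (k + i + 1))
    (hiJ : 2 * φ.manBits - n + 1 ≤ i ∨ (2 * φ.manBits - n = i ∧ 1 ≤ J)) : ¬ DFma φ ψ :=
  not_dFma_of_fmaLadderTest hE hq2 h1 hb hn hn2 hk hM (fmaLadderTest_cap h1 hn3 hiJ)

end Summit.Ventures.CertifiedArithmetic
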